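import Summits.Ventures.PercRepro.MSTightTLGround
import Summits.Ventures.PercRepro.MSTightDefect
import Summits.Ventures.PercRepro.ExcessOneProjection

/-!
# Lemma 1 of Addendum 36: the flipped near-member at a tight trace

Dossier proofs/MINE1-theoremS.md, Addendum 36 (Lemma 1 = (TL) on the trace), Addendum 12 remark
(iv). Let `F` be a family of subsets of a finite type, `u` a set, `r ∈ u` an element whose trace
`P = proj r F` is tight, and suppose every member of `F` is A- or C*-signable for `u`
(`Cells (F \\ F) t u ∨ Cells (F \\ F) t (univ \ u)`). Then the cells of every member of `P` with
respect to `u₁ = u.erase r` inside `S' = univ.erase r` lie in `D(P) = X ∪ Y` — a cell avoiding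
`r` is a difference avoiding `r` (`X`), a cell through `r` is `insert r` of a member of `Y` — so
the ground-set mixed-cell lemma (TL) (`mem_or_sdiff_mem_of_tight_of_subset`) gives
**`u₁ ∈ P` or `S' ∖ u₁ ∈ P`** (`erase_mem_proj_or_sdiff_mem_proj`). With `u ∉ F` and `ū ∉ F`
this reads **`u ∖ r ∈ F` (Case I) or `univ ∖ (u ∖ r) ∈ F` (Case II)**
(`erase_mem_or_compl_erase_mem`); a removable `r` is in Case I and an addable `r` in Case II
(`erase_mem_of_removable`, `compl_erase_mem_of_addable`).
-/

namespace PercRepro.MSTight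

open Finset
open scoped FinsetFamily

variable {α : Type*} [DecidableEq α] [Fintype α]

omit [Fintype α] in
/-- `X ⊆ D(P)`. -/
theorem diffsX_subset_diffs_proj (r : α) (F : Finset (Finset α)) :
    diffsX r F ⊆ proj r F \\ proj r F := by
  rw [diffs_proj_eq]; exact subset_union_left

omit [Fintype α] in
/-- `Y ⊆ D(P)`. -/
theorem diffsY_subset_diffs_proj (r : α) (F : Finset (Finset α)) :
    diffsY r F ⊆ proj r F \\ proj r F := by
  rw [diffs_proj_eq]; exact subset_union_right

omit [Fintype α] in
/-- A difference of `F` avoiding `r` is a difference of the trace. -/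
theorem mem_diffs_proj_of_mem_diffs {r : α} {F : Finset (Finset α)} {E : Finset α}
    (hE : E ∈ F \\ F) (hr : r ∉ E) : E ∈ proj r F \\ proj r F :=
  diffsX_subset_diffs_proj r F (mem_diffsX_iff.2 ⟨hE, hr⟩)

omit [Fintype α] in
/-- A difference of `F` through `r`, with `r` removed, is a difference of the trace. -/
theorem erase_mem_diffs_proj_of_mem_diffs {r : α} {F : Finset (Finset α)} {E : Finset α}
    (hE : E ∈ F \\ F) (hr : r ∈ E) : E.erase r ∈ proj r F \\ proj r F := by
  refine diffsY_subset_diffs_proj r F (mem_diffsY_iff.2 ⟨notMem_erase r E, ?_⟩)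
  rw [insert_erase hr]
  exact hE

/-- **Lemma 1 (the trace form).** At a tight trace `P = proj r F` with `r ∈ u`, if every member of
`F` is A- or C*-signable for `u`, then `u₁ = u.erase r ∈ P` or `S' ∖ u₁ ∈ P`. -/
theorem erase_mem_proj_or_sdiff_mem_proj {F : Finset (Finset α)} {r : α} {u : Finset α}
    (hP : Tight (proj r F)) (hne : F.Nonempty)
    (hsig : ∀ t ∈ F, Cells (F \\ F) t u ∨ Cells (F \\ F) t (univ \ u)) :
    u.erase r ∈ proj r F ∨ univ.erase r \ u.erase r ∈ proj r F := by
  refine mem_or_sdiff_mem_of_tight_of_subset hP ⟨_, mem_proj.2 ⟨hne.choose, hne.choose_spec, rfl⟩⟩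
    (fun p hp => by obtain ⟨t, -, rfl⟩ := mem_proj.1 hp; exact erase_subset_erase r (subset_univ t))
    (u.erase r) (erase_subset_erase r (subset_univ u)) ?_
  intro p hp
  obtain ⟨t, ht, rfl⟩ := mem_proj.1 hp
  -- the four cells of `t.erase r` inside `S'` in terms of the cells of `t`
  have c1 : t.erase r ∩ u.erase r = (t ∩ u).erase r := by
    ext a; simp only [mem_inter, mem_erase]; tauto
  have c2 : (univ.erase r \ t.erase r) ∩ (univ.erase r \ u.erase r) =
      ((univ \ t) ∩ (univ \ u)).erase r := by
    ext a; simp only [mem_inter, mem_sdiff, mem_erase, mem_univ, true_and]; tauto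
  have c3 : t.erase r ∩ (univ.erase r \ u.erase r) = (t ∩ (univ \ u)).erase r := by
    ext a; simp only [mem_inter, mem_sdiff, mem_erase, mem_univ, true_and]; tauto
  have c4 : (univ.erase r \ t.erase r) ∩ u.erase r = ((univ \ t) ∩ (univ \ (univ \ u))).erase r := by
    ext a; simp only [mem_inter, mem_sdiff, mem_erase, mem_univ, true_and, not_not]; tauto
  -- a cell of `t` gives a cell of the trace: erase `r` (a difference through `r`) or keep (avoiding `r`)
  have key : ∀ E ∈ F \\ F, E.erase r ∈ proj r F \\ proj r F := by
    intro E hE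
    by_cases hr : r ∈ E
    · exact erase_mem_diffs_proj_of_mem_diffs hE hr
    · rw [erase_eq_of_notMem hr]; exact mem_diffs_proj_of_mem_diffs hE hr
  rcases hsig t ht with ⟨h1, h2⟩ | ⟨h1, h2⟩
  · left
    rw [c1, c2]
    exact ⟨key _ h1, key _ h2⟩
  · right
    rw [c3, c4]
    exact ⟨key _ h1, key _ h2⟩

/-- **Lemma 1.** With `u ∉ F` and `ū ∉ F`: `u ∖ r ∈ F` (Case I) or `univ ∖ (u ∖ r) ∈ F` (Case II). -/
theorem erase_mem_or_compl_erase_mem {F : Finset (Finset α)} {r : α} {u : Finset α}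
    (hP : Tight (proj r F)) (hne : F.Nonempty) (hru : r ∈ u) (hu : u ∉ F) (hu' : univ \ u ∉ F)
    (hsig : ∀ t ∈ F, Cells (F \\ F) t u ∨ Cells (F \\ F) t (univ \ u)) :
    u.erase r ∈ F ∨ univ \ u.erase r ∈ F := by
  rcases erase_mem_proj_or_sdiff_mem_proj hP hne hsig with h | h
  · left
    rcases mem_union.1 ((proj_eq_union r F) ▸ h) with h0 | h1
    · exact (mem_part0.1 h0).1
    · exfalso
      have := (mem_partr.1 h1).2
      rw [insert_erase hru] at this
      exact hu this
  · right
    have heq : univ.erase r \ u.erase r = univ \ u := by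
      ext a
      simp only [mem_sdiff, mem_erase, mem_univ, true_and, and_true, ne_eq, not_and]
      constructor
      · rintro ⟨har, h'⟩; exact h' har
      · intro hau; exact ⟨fun h' => hau (h' ▸ hru), fun _ => hau⟩
    rw [heq] at h
    rcases mem_union.1 ((proj_eq_union r F) ▸ h) with h0 | h1
    · exact absurd (mem_part0.1 h0).1 hu'
    · have := (mem_partr.1 h1).2
      have heq2 : insert r (univ \ u) = univ \ u.erase r := by
        ext a
        simp only [mem_insert, mem_sdiff, mem_univ, true_and, mem_erase, ne_eq, not_and]
        constructor
        · rintro (rfl | hau)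
          · exact fun h' => absurd rfl h'
          · exact fun _ => hau
        · intro h'
          by_cases har : a = r
          · exact Or.inl har
          · exact Or.inr (h' har)
      rw [heq2] at this
      exact this

/-- A removable element (`partr r F ⊆ part0 r F`) is in Case I. -/
theorem erase_mem_of_removable {F : Finset (Finset α)} {r : α} {u : Finset α}
    (hP : Tight (proj r F)) (hne : F.Nonempty) (hru : r ∈ u) (hu : u ∉ F) (hu' : univ \ u ∉ F)
    (hsig : ∀ t ∈ F, Cells (F \\ F) t u ∨ Cells (F \\ F) t (univ \ u))
    (hrem : partr r F ⊆ part0 r F) : u.erase r ∈ F := by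
  rcases erase_mem_or_compl_erase_mem hP hne hru hu hu' hsig with h | h
  · exact h
  · exfalso
    -- `ū = (univ ∖ (u ∖ r)).erase r ∈ partr ⊆ part0`, so `ū ∈ F`
    have h1 : (univ \ u.erase r).erase r ∈ partr r F := by
      refine mem_partr.2 ⟨notMem_erase r _, ?_⟩
      rw [insert_erase (mem_sdiff.2 ⟨mem_univ r, notMem_erase r u⟩)]
      exact h
    have h2 := (mem_part0.1 (hrem h1)).1
    have heq : (univ \ u.erase r).erase r = univ \ u := by
      ext a
      simp only [mem_erase, mem_sdiff, mem_univ, true_and, ne_eq, not_and]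
      constructor
      · rintro ⟨har, h'⟩; exact h' har
      · intro hau; exact ⟨fun h' => hau (h' ▸ hru), fun _ => hau⟩
    rw [heq] at h2
    exact hu' h2

/-- An addable element (`part0 r F ⊆ partr r F`) is in Case II. -/
theorem compl_erase_mem_of_addable {F : Finset (Finset α)} {r : α} {u : Finset α}
    (hP : Tight (proj r F)) (hne : F.Nonempty) (hru : r ∈ u) (hu : u ∉ F) (hu' : univ \ u ∉ F)
    (hsig : ∀ t ∈ F, Cells (F \\ F) t u ∨ Cells (F \\ F) t (univ \ u))
    (hadd : part0 r F ⊆ partr r F) : univ \ u.erase r ∈ F := by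
  rcases erase_mem_or_compl_erase_mem hP hne hru hu hu' hsig with h | h
  · exfalso
    have h1 : u.erase r ∈ part0 r F := mem_part0.2 ⟨h, notMem_erase r u⟩
    have h2 := (mem_partr.1 (hadd h1)).2
    rw [insert_erase hru] at h2
    exact hu h2
  · exact h

end PercRepro.MSTight
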